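import Mathlib
import Summits.NavierStokesRegularity.NavierStokesRegularity.Theorems.LerayQuarterDissipationFiniteDissipationLiouvilleCaloricDefect
import HarnessLib

/-!
# Crux `FiniteDissipationLiouville` (stmt-NavierStokesRegularity-22144): THE CALORIC DEFECT OF THE VORTICITY, II —
# the curl of the Lamb vector of the hypothetical singular profile exceeds a definite dimensionless floor on a
# parabolic cylinder in EVERY window, and somewhere in EVERY parabolic cylinder of the core, at every scale

Theorems file of route `LerayQuarterDissipation` (lead prover g20; `--supports` the crux; file 2/2 of the g20 axis, sequel
of `…CaloricDefect` and of lead g19's blob socket `…WindowBlobSocket` / `…WindowBlobJets`). Navier–Stokes regularity is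
NOT proved by anything here; no summit is.

With the kill of file 1 (`not_singular_of_lambCurlBound_finalSlab`, `eq_zero_of_lambCurl_isOpen`) and the scale
covariance of `t²‖(W·∇)ω − (ω·∇)W‖`:

* `lambCurl_ball` — ball transfer along `seqLimit₂`-convergent sequences with thresholds `θ_j → 0` (continuous
  convergence of the 2-jet, `jet_tendsto_prod`);
* **`lambCurl_blob_in_every_window` (crux frame `𝒟_{C,K}`) / `…_envelope` (law-free enveloped frame)** — there are
  `ε ∈ (0,1)`, `ρ > 0`, `δ > 0` such that every SINGULAR member contains, in EVERY window `[−c², −εc²]`, a parabolic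
  cylinder `[t₀ − (ρc)², t₀] × B(x₀, ρc)` on which `t²‖(W·∇)ω − (ω·∇)W‖ > δ` (g19's blob socket
  `exists_blob_margin_of_apex_kill` at `θ₀ = 0`);
* **`lambCurl_floor_unit`, `lambCurl_floor_every_cylinder` (+ `_envelope`) — THE DENSE FLOOR** — for all
  `C, K, ρ, r > 0` there is `δ > 0` such that for every singular member of `𝒟_{C,K}`, every scale `c > 0` and every
  centre `‖x₀‖ ≤ ρc`, the cylinder `(−c² − (rc)², −c²) × B(x₀, rc)` contains a point with `t²‖(W·∇)ω − (ω·∇)W‖ > δ`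
  (direct compactness: a violation-free cylinder would survive in a KNSS limit as an OPEN space–time zero set of the
  jointly analytic commutator of a singular member — persistence `persistent_singularity_seq` — which the kill forbids).

Portrait clause of the registered stub `stub_envelopeCriticalLiouville` (skeleton `Lines/birth.lean`): in the
hypothetical finite-dissipation Type-I singularity the transport of vorticity NEVER balances its stretching — not on any
open space–time set, and quantitatively not below the floor `δ/t²` on any parabolic cylinder of relative size `r`
centred in the core `‖x‖ ≤ ρ√(−t)`, uniformly over the class and over all scales, with a whole violating cylinder of
relative size `ρ'` recurring in every log-time window. Instrument row: on a candidate (R)DSS profile in Leray variables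
the field `(U·∇)Ω − (Ω·∇)U` (curl of the Lamb vector) must be bounded away from zero on every parabolic sub-cylinder of
the core — a profile on which it vanishes on an open set is not a counterexample (it is zero).

HONEST FRAMING. A compactness corollary (ineffective `ε, ρ, δ`) of a kill that was already in the tree, about a
HYPOTHETICAL object; nothing is removed from the DSS wall (`∀ c>1 TypeIDSSLiouville c`, NECESSARY for the crux by
`…Hardness`); the verdict of the line is unchanged (FRONTIER). Nothing here bears on Navier–Stokes regularity.

References: Koch–Nadirashvili–Seregin–Šverák, Acta Math. 203 (2009) §4 (the class, compactness); P. G. Lemarié-Rieusset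
(2016), Thm 9.12; folklore.
-/

noncomputable section

set_option linter.dupNamespace false

namespace Summit.NavierStokesRegularity.NavierStokesRegularity.Theorems.FiniteDissipationLiouville.CaloricDefect

open MeasureTheory Set Filter Topology Metric InnerProductSpace Function Real
open scoped RealInnerProductSpace ContDiff ENNReal
open Literature.Analysis Literature.Analysis.FluidPDE
open Summit.NavierStokesRegularity.NavierStokesRegularity.Theorems
open Summit.NavierStokesRegularity.NavierStokesRegularity.Theorems.RecurrentReductionD
open Summit.NavierStokesRegularity.NavierStokesRegularity.Theorems.FiniteDissipationLiouville
open Summit.NavierStokesRegularity.NavierStokesRegularity.Theorems.FiniteDissipationLiouville.CrossFlow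
open Summit.NavierStokesRegularity.NavierStokesRegularity.Theorems.FiniteDissipationLiouville.EndpointScheme
open Summit.NavierStokesRegularity.NavierStokesRegularity.Theorems.FiniteDissipationLiouville.WindowSocket
open Summit.NavierStokesRegularity.NavierStokesRegularity.Theorems.FiniteDissipationLiouville.WindowRecurrence
open Summit.NavierStokesRegularity.NavierStokesRegularity.Theorems.FiniteDissipationLiouville.Compactness
open Summit.NavierStokesRegularity.NavierStokesRegularity.Theorems.LocalLambTubeDoorGeneralisedBeltramiProfileRigidity

variable {C : ℝ}

/-! ### Ball transfer along KNSS-convergent sequences -/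

section Ball

/-- **Ball transfer for the caloric defect with thresholds `θ_j → 0`.** If the limit has `t₀²‖comm W (t₀, x₀)‖ > 0`,
then for all large `j` the approximants violate `t²‖comm v_j‖ ≤ θ_j` on a whole ball around `(t₀, x₀)` (continuous
convergence of the 2-jet, `jet_tendsto_prod`). [cite: KochNadirashviliSereginSverak2009, Prop. 4.1 (arXiv:0709.3599 p. 8)] -/
theorem lambCurl_ball {v : ℕ → ℝ → EuclideanSpace ℝ (Fin 3) → EuclideanSpace ℝ (Fin 3)}
    {W : ℝ → EuclideanSpace ℝ (Fin 3) → EuclideanSpace ℝ (Fin 3)} {θ : ℕ → ℝ}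
    (hv : ∀ j, IsTypeIAncientMild C (v j)) (hW : IsTypeIAncientMild C W)
    (hunif : ∀ n : ℕ, TendstoUniformlyOn (fun j z => v j z.1 z.2) (fun z => W z.1 z.2) atTop
      (Icc (-((n : ℝ) + 2)) (-(1 / ((n : ℝ) + 2))) ×ˢ
        closedBall (0 : EuclideanSpace ℝ (Fin 3)) ((n : ℝ) + 2)))
    (hunifG : ∀ n : ℕ, TendstoUniformlyOn (fun j z => fderiv ℝ (v j z.1) z.2) (fun z => fderiv ℝ (W z.1) z.2)
      atTop (Icc (-((n : ℝ) + 2)) (-(1 / ((n : ℝ) + 2))) ×ˢ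
        closedBall (0 : EuclideanSpace ℝ (Fin 3)) ((n : ℝ) + 2)))
    (hunifH : ∀ n : ℕ, TendstoUniformlyOn (fun j z => fderiv ℝ (fderiv ℝ (v j z.1)) z.2)
      (fun z => fderiv ℝ (fderiv ℝ (W z.1)) z.2)
      atTop (Icc (-((n : ℝ) + 2)) (-(1 / ((n : ℝ) + 2))) ×ˢ
        closedBall (0 : EuclideanSpace ℝ (Fin 3)) ((n : ℝ) + 2)))
    (hθ : Tendsto θ atTop (𝓝 0)) {t₀ : ℝ} (ht₀ : t₀ < 0) (x₀ : EuclideanSpace ℝ (Fin 3))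
    (hbad : ¬ t₀ ^ 2 * ‖fderiv ℝ (curl (W t₀)) x₀ (W t₀ x₀) - fderiv ℝ (W t₀) x₀ (curl (W t₀) x₀)‖ ≤ 0) :
    ∃ r : ℝ, 0 < r ∧ ∀ᶠ j in atTop, ∀ q : ℝ × EuclideanSpace ℝ (Fin 3), dist q (t₀, x₀) < r →
      ¬ q.1 ^ 2 * ‖fderiv ℝ (curl (v j q.1)) q.2 (v j q.1 q.2) - fderiv ℝ (v j q.1) q.2 (curl (v j q.1) q.2)‖ ≤
        θ j := by
  obtain ⟨s, hs, hT, h0, h1, -, h3, h4⟩ := jet_tendsto_prod hv hW hunif hunifG hunifH ht₀ x₀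
  have hA := tendsto_clm_apply_filter h4 h0
  have hB := tendsto_clm_apply_filter h3 h1
  have hR : Tendsto (fun q : ℕ × (ℝ × EuclideanSpace ℝ (Fin 3)) =>
      q.2.1 ^ 2 * ‖fderiv ℝ (curl (v q.1 q.2.1)) q.2.2 (v q.1 q.2.1 q.2.2) -
        fderiv ℝ (v q.1 q.2.1) q.2.2 (curl (v q.1 q.2.1) q.2.2)‖) (atTop ×ˢ 𝓝[s] (t₀, x₀))
      (𝓝 (t₀ ^ 2 * ‖fderiv ℝ (curl (W t₀)) x₀ (W t₀ x₀) - fderiv ℝ (W t₀) x₀ (curl (W t₀) x₀)‖)) :=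
    (hT.pow 2).mul (hA.sub hB).norm
  have hθ' : Tendsto (fun q : ℕ × (ℝ × EuclideanSpace ℝ (Fin 3)) => θ q.1) (atTop ×ˢ 𝓝[s] (t₀, x₀)) (𝓝 0) :=
    hθ.comp tendsto_fst
  rw [not_le] at hbad
  have hev := hθ'.eventually_lt hR hbad
  obtain ⟨r, hr, hball⟩ := exists_ball_eventually_of_prod_nhds hs hev
  exact ⟨r, hr, hball.mono fun j hj q hq => not_le.2 (hj q hq)⟩

end Ball

/-! ### The caloric defect fills a parabolic cylinder of definite relative size in every window -/

section Blob

/-- **THE CALORIC DEFECT FILLS A PARABOLIC CYLINDER IN EVERY WINDOW (crux frame).** For all `C, K` there are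
`ε ∈ (0,1)`, `ρ > 0`, `δ > 0` such that every singular member of `𝒟_{C,K}` contains, in every window `[−c², −εc²]`,
a cylinder `[t₀ − (ρc)², t₀] × B(x₀, ρc)` on which `t²‖(W·∇)ω − (ω·∇)W‖ > δ`.
[generalised-Beltrami rigidity + space–time analyticity + KNSS compactness;
cite: KochNadirashviliSereginSverak2009, §4 (arXiv:0709.3599 p. 8)] -/
theorem lambCurl_blob_in_every_window (C K : ℝ) : ∃ ε : ℝ, 0 < ε ∧ ε < 1 ∧ ∃ ρ : ℝ, 0 < ρ ∧
    ∃ δ : ℝ, 0 < δ ∧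
    ∀ (V : ℝ → EuclideanSpace ℝ (Fin 3) → EuclideanSpace ℝ (Fin 3)), IsTypeIAncientMild C V →
      (∀ s : ℝ, s < 0 → ∫⁻ x, ‖fderiv ℝ (V s) x‖ₑ ^ 2 ≤ ENNReal.ofReal (K / Real.sqrt (-s))) →
      (∀ r > 0, ∀ M : ℝ, ∃ t ∈ Ioo (-(r ^ 2)) (0 : ℝ),
        ∃ x ∈ ball (0 : EuclideanSpace ℝ (Fin 3)) r, M < ‖V t x‖) →
      ∀ c : ℝ, 0 < c → ∃ (t₀ : ℝ) (x₀ : EuclideanSpace ℝ (Fin 3)),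
        Icc (t₀ - (ρ * c) ^ 2) t₀ ⊆ Icc (-c ^ 2) (-(ε * c ^ 2)) ∧
        ∀ t ∈ Icc (t₀ - (ρ * c) ^ 2) t₀, ∀ x ∈ ball x₀ (ρ * c),
          δ < t ^ 2 * ‖fderiv ℝ (curl (V t)) x (V t x) - fderiv ℝ (V t) x (curl (V t) x)‖ := by
  obtain ⟨ε, hε, hε1, ρ, hρ, δ, hδ, h⟩ := exists_blob_margin_of_apex_kill (C := C) (K := K) (θ₀ := 0)
    (Q := fun _ => True)
    (G := fun θ F s y => s ^ 2 * ‖fderiv ℝ (curl (F s)) y (F s y) - fderiv ℝ (F s) y (curl (F s) y)‖ ≤ θ)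
    (fun _ _ _ _ _ _ => trivial)
    (fun u W θ hu hW hunif hunifG hunifH hθ t₀ ht₀ x₀ hbad =>
      lambCurl_ball hu hW hunif hunifG hunifH hθ ht₀ x₀ hbad)
    (fun W hW _ _ hG => not_singular_of_lambCurlBound_finalSlab hW hG)
  refine ⟨ε, hε, hε1, ρ, hρ, δ, hδ, fun V hV hlaw hsing c hc => ?_⟩
  obtain ⟨t₀, x₀, hwin, hblob⟩ := h (nsRescale c V) (hV.nsRescale hc) (dissipationLaw_nsRescale hlaw hc)
    trivial (singularAtOrigin_nsRescale hsing hc)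
  obtain ⟨hwin', hblob'⟩ := blob_rescale (θ := 0 + δ) (ε := ε) (ρ := ρ) (c := c)
    (G := fun θ F s y => s ^ 2 * ‖fderiv ℝ (curl (F s)) y (F s y) - fderiv ℝ (F s) y (curl (F s) y)‖ ≤ θ)
    (fun F c' s y hc' _ hG => lambCurlBound_at_nsRescale F (0 + δ) y hc' hG) hc hε hwin hblob
  refine ⟨c ^ 2 * t₀, c • x₀, hwin', fun t ht x hx => ?_⟩
  have := not_le.1 (hblob' t ht x hx)
  linarith

/-- **THE CALORIC DEFECT FILLS A PARABOLIC CYLINDER IN EVERY WINDOW (law-free enveloped frame).** For every `A`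
there are `ε ∈ (0,1)`, `ρ > 0`, `δ > 0` such that every singular Type-I field with constant `C ≤ A` and the envelope
`‖V(t,x)‖ ≤ A/(‖x‖ + √(−t))` contains, in every window `[−c², −εc²]`, a cylinder of relative size `ρ` on which
`t²‖(W·∇)ω − (ω·∇)W‖ > δ`. [cite: KochNadirashviliSereginSverak2009, §4 (arXiv:0709.3599 p. 8)] -/
theorem lambCurl_blob_in_every_window_envelope (A : ℝ) : ∃ ε : ℝ, 0 < ε ∧ ε < 1 ∧ ∃ ρ : ℝ, 0 < ρ ∧
    ∃ δ : ℝ, 0 < δ ∧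
    ∀ (C : ℝ) (V : ℝ → EuclideanSpace ℝ (Fin 3) → EuclideanSpace ℝ (Fin 3)),
      IsTypeIAncientMild C V → C ≤ A → HasTypeIDecay A V →
      (∀ r > 0, ∀ M : ℝ, ∃ t ∈ Ioo (-(r ^ 2)) (0 : ℝ),
        ∃ x ∈ ball (0 : EuclideanSpace ℝ (Fin 3)) r, M < ‖V t x‖) →
      ∀ c : ℝ, 0 < c → ∃ (t₀ : ℝ) (x₀ : EuclideanSpace ℝ (Fin 3)),
        Icc (t₀ - (ρ * c) ^ 2) t₀ ⊆ Icc (-c ^ 2) (-(ε * c ^ 2)) ∧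
        ∀ t ∈ Icc (t₀ - (ρ * c) ^ 2) t₀, ∀ x ∈ ball x₀ (ρ * c),
          δ < t ^ 2 * ‖fderiv ℝ (curl (V t)) x (V t x) - fderiv ℝ (V t) x (curl (V t) x)‖ := by
  obtain ⟨ε, hε, hε1, ρ, hρ, δ, hδ, h⟩ := exists_blob_margin_of_apex_kill_envelope (C := A) (θ₀ := 0)
    (G := fun θ F s y => s ^ 2 * ‖fderiv ℝ (curl (F s)) y (F s y) - fderiv ℝ (F s) y (curl (F s) y)‖ ≤ θ)
    (fun u W θ hu hW hunif hunifG hunifH hθ t₀ ht₀ x₀ hbad =>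
      lambCurl_ball hu hW hunif hunifG hunifH hθ ht₀ x₀ hbad)
    (fun W hW _ hG => not_singular_of_lambCurlBound_finalSlab hW hG)
  refine ⟨ε, hε, hε1, ρ, hρ, δ, hδ, fun C V hV hCA hdec hsing c hc => ?_⟩
  obtain ⟨t₀, x₀, hwin, hblob⟩ := h (nsRescale c V) ((isTypeIAncientMild_of_le hV hCA).nsRescale hc)
    (hdec.nsRescale hc) (singularAtOrigin_nsRescale hsing hc)
  obtain ⟨hwin', hblob'⟩ := blob_rescale (θ := 0 + δ) (ε := ε) (ρ := ρ) (c := c)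
    (G := fun θ F s y => s ^ 2 * ‖fderiv ℝ (curl (F s)) y (F s y) - fderiv ℝ (F s) y (curl (F s) y)‖ ≤ θ)
    (fun F c' s y hc' _ hG => lambCurlBound_at_nsRescale F (0 + δ) y hc' hG) hc hε hwin hblob
  refine ⟨c ^ 2 * t₀, c • x₀, hwin', fun t ht x hx => ?_⟩
  have := not_le.1 (hblob' t ht x hx)
  linarith

end Blob

/-! ### The dense floor: a definite caloric defect somewhere in EVERY parabolic cylinder of the core -/

section Dense

/-- **THE DENSE FLOOR AT UNIT SCALE (crux frame).** For all `C, K, ρ ≥ 0, r > 0` there is `δ > 0` such that for every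
singular member `V` of `𝒟_{C,K}` and every centre `‖x₀‖ ≤ ρ` the cylinder `(−1 − r², −1) × B(x₀, r)` contains a point
with `t²‖(V·∇)ω − (ω·∇)V‖ > δ`: a violation-free cylinder would survive in a KNSS limit as an OPEN space–time zero set
of the jointly analytic commutator of a singular member, which the kill forbids.
[generalised-Beltrami rigidity + space–time analyticity + KNSS compactness;
cite: KochNadirashviliSereginSverak2009, §4 (arXiv:0709.3599 p. 8)] -/
theorem lambCurl_floor_unit (C K : ℝ) {ρ r : ℝ} (hr : 0 < r) :
    ∃ δ : ℝ, 0 < δ ∧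
    ∀ (V : ℝ → EuclideanSpace ℝ (Fin 3) → EuclideanSpace ℝ (Fin 3)), IsTypeIAncientMild C V →
      (∀ s : ℝ, s < 0 → ∫⁻ x, ‖fderiv ℝ (V s) x‖ₑ ^ 2 ≤ ENNReal.ofReal (K / Real.sqrt (-s))) →
      (∀ r > 0, ∀ M : ℝ, ∃ t ∈ Ioo (-(r ^ 2)) (0 : ℝ),
        ∃ x ∈ ball (0 : EuclideanSpace ℝ (Fin 3)) r, M < ‖V t x‖) →
      ∀ x₀ : EuclideanSpace ℝ (Fin 3), ‖x₀‖ ≤ ρ →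
        ∃ t ∈ Ioo (-1 - r ^ 2) (-1 : ℝ), ∃ x ∈ ball x₀ r,
          δ < t ^ 2 * ‖fderiv ℝ (curl (V t)) x (V t x) - fderiv ℝ (V t) x (curl (V t) x)‖ := by
  by_contra hcon
  push Not at hcon
  have hbad : ∀ j : ℕ, ∃ (V : ℝ → EuclideanSpace ℝ (Fin 3) → EuclideanSpace ℝ (Fin 3))
      (x₀ : EuclideanSpace ℝ (Fin 3)), IsTypeIAncientMild C V ∧
      (∀ s : ℝ, s < 0 → ∫⁻ x, ‖fderiv ℝ (V s) x‖ₑ ^ 2 ≤ ENNReal.ofReal (K / Real.sqrt (-s))) ∧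
      (∀ r > 0, ∀ M : ℝ, ∃ t ∈ Ioo (-(r ^ 2)) (0 : ℝ),
        ∃ x ∈ ball (0 : EuclideanSpace ℝ (Fin 3)) r, M < ‖V t x‖) ∧ ‖x₀‖ ≤ ρ ∧
      ∀ t ∈ Ioo (-1 - r ^ 2) (-1 : ℝ), ∀ x ∈ ball x₀ r,
        t ^ 2 * ‖fderiv ℝ (curl (V t)) x (V t x) - fderiv ℝ (V t) x (curl (V t) x)‖ ≤ 1 / ((j : ℝ) + 1) := by
    intro j
    obtain ⟨V, hV, hlaw, hsing, x₀, hx₀, hno⟩ := hcon (1 / ((j : ℝ) + 1)) (by positivity)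
    exact ⟨V, x₀, hV, hlaw, hsing, hx₀, hno⟩
  choose V x₀ hV hlaw hsing hx₀ hsmall using hbad
  -- ## compactness of the centres, then KNSS compactness across members
  obtain ⟨xinf, -, φ, hφ, hxlim⟩ := (isCompact_closedBall (0 : EuclideanSpace ℝ (Fin 3)) ρ).tendsto_subseq
    (fun j => mem_closedBall_zero_iff.2 (hx₀ j))
  obtain ⟨ψ, hψ, W, hW, hunif, hpt, hgr, -, -⟩ := Compactness.seqLimit₂ (w := fun j => V (φ j)) (fun j => hV _)
  have hψt : Tendsto ψ atTop atTop := hψ.tendsto_atTop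
  have hWsing := Compactness.persistent_singularity_seq (w := fun j => V (φ (ψ j)))
    (fun j => hV _) (fun j => hlaw _) (fun j => hsing _) hW hunif
  -- ## the commutator of the limit vanishes on the open cylinder `(−1 − r², −1) × B(x∞, r)`
  have hzero : ∀ z ∈ Ioo (-1 - r ^ 2) (-1 : ℝ) ×ˢ ball xinf r,
      fderiv ℝ (curl (W z.1)) z.2 (W z.1 z.2) - fderiv ℝ (W z.1) z.2 (curl (W z.1) z.2) = 0 := by
    rintro ⟨t, x⟩ ⟨ht, hx⟩
    have ht0 : t < 0 := lt_trans ht.2 (by norm_num)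
    have h0 : Tendsto (fun j => V (φ (ψ j)) t x) atTop (𝓝 (W t x)) := hpt t ht0 x
    have h3 : Tendsto (fun j => fderiv ℝ (V (φ (ψ j)) t) x) atTop (𝓝 (fderiv ℝ (W t) x)) := hgr t ht0 x
    have h1 : Tendsto (fun j => curl (V (φ (ψ j)) t) x) atTop (𝓝 (curl (W t) x)) := by
      simp only [curl_eq_curlCLM]
      exact ((curlCLM : (EuclideanSpace ℝ (Fin 3) →L[ℝ] EuclideanSpace ℝ (Fin 3)) →L[ℝ]
        EuclideanSpace ℝ (Fin 3)).continuous.tendsto _).comp h3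
    have h4 : Tendsto (fun j => fderiv ℝ (curl (V (φ (ψ j)) t)) x) atTop (𝓝 (fderiv ℝ (curl (W t)) x)) :=
      tendsto_fderiv_curl_of_unif (v := fun j => V (φ (ψ j))) (fun j => hV _) hW hunif ht0 x
    have hlim : Tendsto (fun j => t ^ 2 * ‖fderiv ℝ (curl (V (φ (ψ j)) t)) x (V (φ (ψ j)) t x) -
        fderiv ℝ (V (φ (ψ j)) t) x (curl (V (φ (ψ j)) t) x)‖) atTop
        (𝓝 (t ^ 2 * ‖fderiv ℝ (curl (W t)) x (W t x) - fderiv ℝ (W t) x (curl (W t) x)‖)) :=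
      ((tendsto_clm_apply_filter h4 h0).sub (tendsto_clm_apply_filter h3 h1)).norm.const_mul _
    -- eventually `x` lies in the `j`-th cylinder
    have hxlim' : Tendsto (fun j => x₀ (φ (ψ j))) atTop (𝓝 xinf) := hxlim.comp hψt
    have hxr : dist x xinf < r := mem_ball.1 hx
    have hxev : ∀ᶠ j in atTop, x ∈ ball (x₀ (φ (ψ j))) r := by
      have hd : ∀ᶠ j in atTop, dist (x₀ (φ (ψ j))) xinf < r - dist x xinf :=
        Metric.tendsto_nhds.1 hxlim' _ (by linarith)
      filter_upwards [hd] with j hj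
      rw [mem_ball]
      calc dist x (x₀ (φ (ψ j))) ≤ dist x xinf + dist xinf (x₀ (φ (ψ j))) := dist_triangle _ _ _
        _ = dist x xinf + dist (x₀ (φ (ψ j))) xinf := by rw [dist_comm xinf]
        _ < r := by linarith
    -- the thresholds tend to zero along the subsequence
    have hφψ : Tendsto (fun j => φ (ψ j)) atTop atTop := hφ.tendsto_atTop.comp hψt
    have hεj : Tendsto (fun j => 1 / (((φ (ψ j) : ℕ) : ℝ) + 1)) atTop (𝓝 0) :=
      tendsto_one_div_add_atTop_nhds_zero_nat.comp hφψ
    have hle : t ^ 2 * ‖fderiv ℝ (curl (W t)) x (W t x) - fderiv ℝ (W t) x (curl (W t) x)‖ ≤ 0 :=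
      le_of_tendsto_of_tendsto hlim hεj (hxev.mono fun j hj => hsmall (φ (ψ j)) t ht x hj)
    have ht2 : 0 < t ^ 2 := by nlinarith
    have hn : ‖fderiv ℝ (curl (W t)) x (W t x) - fderiv ℝ (W t) x (curl (W t) x)‖ ≤ 0 := by
      by_contra hc
      push Not at hc
      have := mul_pos ht2 hc
      linarith
    exact norm_le_zero_iff.1 hn
  have hUopen : IsOpen (Ioo (-1 - r ^ 2) (-1 : ℝ) ×ˢ ball xinf r) := isOpen_Ioo.prod isOpen_ball
  have hUsub : Ioo (-1 - r ^ 2) (-1 : ℝ) ×ˢ ball xinf r ⊆ Iio (0 : ℝ) ×ˢ univ := fun z hz =>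
    ⟨show z.1 < 0 from lt_trans hz.1.2 (by norm_num), mem_univ _⟩
  have hUne : (Ioo (-1 - r ^ 2) (-1 : ℝ) ×ˢ ball xinf r).Nonempty := by
    refine ⟨(-1 - r ^ 2 / 2, xinf), ⟨?_, ?_⟩, mem_ball_self hr⟩
    · show -1 - r ^ 2 < -1 - r ^ 2 / 2
      nlinarith
    · show -1 - r ^ 2 / 2 < -1
      nlinarith
  have hW0 := eq_zero_of_lambCurl_isOpen hW hUopen hUsub hUne hzero
  obtain ⟨t, ht, x, -, hM⟩ := hWsing 1 one_pos 0
  rw [hW0 t ht.2 x, norm_zero] at hM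
  exact lt_irrefl _ hM

/-- **THE DENSE FLOOR AT EVERY SCALE (crux frame).** For all `C, K, ρ ≥ 0, r > 0` there is `δ > 0` such that for
every singular member `V` of `𝒟_{C,K}`, every scale `c > 0` and every centre `‖x₀‖ ≤ ρc`, the backward parabolic
cylinder `(−c² − (rc)², −c²) × B(x₀, rc)` contains a point with `t²‖(V·∇)ω − (ω·∇)V‖ > δ` (scale invariance of
`t²‖comm‖`). [cite: KochNadirashviliSereginSverak2009, §4 (arXiv:0709.3599 p. 8)] -/
theorem lambCurl_floor_every_cylinder (C K : ℝ) {ρ r : ℝ} (hr : 0 < r) :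
    ∃ δ : ℝ, 0 < δ ∧
    ∀ (V : ℝ → EuclideanSpace ℝ (Fin 3) → EuclideanSpace ℝ (Fin 3)), IsTypeIAncientMild C V →
      (∀ s : ℝ, s < 0 → ∫⁻ x, ‖fderiv ℝ (V s) x‖ₑ ^ 2 ≤ ENNReal.ofReal (K / Real.sqrt (-s))) →
      (∀ r > 0, ∀ M : ℝ, ∃ t ∈ Ioo (-(r ^ 2)) (0 : ℝ),
        ∃ x ∈ ball (0 : EuclideanSpace ℝ (Fin 3)) r, M < ‖V t x‖) →
      ∀ c : ℝ, 0 < c → ∀ x₀ : EuclideanSpace ℝ (Fin 3), ‖x₀‖ ≤ ρ * c →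
        ∃ t ∈ Ioo (-c ^ 2 - (r * c) ^ 2) (-c ^ 2), ∃ x ∈ ball x₀ (r * c),
          δ < t ^ 2 * ‖fderiv ℝ (curl (V t)) x (V t x) - fderiv ℝ (V t) x (curl (V t) x)‖ := by
  obtain ⟨δ, hδ, h⟩ := lambCurl_floor_unit C K (ρ := ρ) hr
  refine ⟨δ, hδ, fun V hV hlaw hsing c hc x₀ hx₀ => ?_⟩
  have hx₀' : ‖c⁻¹ • x₀‖ ≤ ρ := by
    rw [norm_smul, norm_inv, Real.norm_of_nonneg hc.le, inv_mul_le_iff₀ hc, mul_comm]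
    exact hx₀
  obtain ⟨t, ht, x, hx, hδt⟩ := h (nsRescale c V) (hV.nsRescale hc) (dissipationLaw_nsRescale hlaw hc)
    (singularAtOrigin_nsRescale hsing hc) (c⁻¹ • x₀) hx₀'
  have hc2 : 0 < c ^ 2 := by positivity
  refine ⟨c ^ 2 * t, ⟨by nlinarith [ht.1], by nlinarith [ht.2]⟩, c • x, ?_, ?_⟩
  · rw [mem_ball, dist_eq_norm] at hx ⊢
    have e : c • x - x₀ = c • (x - c⁻¹ • x₀) := by
      rw [smul_sub, smul_smul, mul_inv_cancel₀ hc.ne', one_smul]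
    rw [e, norm_smul, Real.norm_of_nonneg hc.le]
    calc c * ‖x - c⁻¹ • x₀‖ < c * r := mul_lt_mul_of_pos_left hx hc
      _ = r * c := mul_comm _ _
  · rwa [sq_mul_norm_lambCurl_nsRescale V hc t x] at hδt

/-- **THE DENSE FLOOR ON THE ENVELOPED CLASS (law-free).** The same for every singular Type-I field with constant
`C ≤ A` and envelope constant `A` (the enveloped class carries a uniform dissipation law,
`exists_uniform_law_of_envelope`). [cite: KochNadirashviliSereginSverak2009, §4 (arXiv:0709.3599 p. 8)] -/
theorem lambCurl_floor_every_cylinder_envelope (A : ℝ) {ρ r : ℝ} (hr : 0 < r) :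
    ∃ δ : ℝ, 0 < δ ∧
    ∀ (C : ℝ) (V : ℝ → EuclideanSpace ℝ (Fin 3) → EuclideanSpace ℝ (Fin 3)), IsTypeIAncientMild C V → C ≤ A →
      HasTypeIDecay A V →
      (∀ r > 0, ∀ M : ℝ, ∃ t ∈ Ioo (-(r ^ 2)) (0 : ℝ),
        ∃ x ∈ ball (0 : EuclideanSpace ℝ (Fin 3)) r, M < ‖V t x‖) →
      ∀ c : ℝ, 0 < c → ∀ x₀ : EuclideanSpace ℝ (Fin 3), ‖x₀‖ ≤ ρ * c →
        ∃ t ∈ Ioo (-c ^ 2 - (r * c) ^ 2) (-c ^ 2), ∃ x ∈ ball x₀ (r * c),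
          δ < t ^ 2 * ‖fderiv ℝ (curl (V t)) x (V t x) - fderiv ℝ (V t) x (curl (V t) x)‖ := by
  obtain ⟨K, hK⟩ := LambProduct.exists_uniform_law_of_envelope A
  obtain ⟨δ, hδ, h⟩ := lambCurl_floor_every_cylinder A K (ρ := ρ) hr
  exact ⟨δ, hδ, fun C V hV hCA hdec hsing => h V (isTypeIAncientMild_of_le hV hCA)
    (hK (isTypeIAncientMild_of_le hV hCA) hdec) hsing⟩

end Dense

end Summit.NavierStokesRegularity.NavierStokesRegularity.Theorems.FiniteDissipationLiouville.CaloricDefect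

end
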